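import Summits.ValiantsHypothesis.ValiantsHypothesis.Theorems.DefinabilityGapThreeGatesPatched
import HarnessLib

/-!
# Definability gap — FOUR-GATE TOOLS (O-L5-LEVEL, F-N₃a): re-orientation, collapses, the FREE and STUCK halves

Helper lane `--supports stmt-ValiantsHypothesis-23704 --as helper` (cites KabanetsImpagliazzo2003,
NisanWigderson1994); route `route-ValiantsHypothesis-DefinabilityGap` (draft). DEF-FREE tools for THEOREM B
(`DefinabilityGapGraphicalFour`): the DEF-FREE split (sub-scope (b) of the CALL) of F-N₃. Everything BY NAME from
`DefinabilityGapThreeGatesPatched` (THEOREM A), `…SlideSupport`, `…SlideCount`, `…EdgeGates`, `…ClusterMerging`;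
nothing re-derived.

CONTENT. `exists_oriented` (pinned header): every loopless gate is `±` a gate of the same size on ORIENTED edges
with the same endpoints up to swap. `eprod_map_repL_eq_zero_of_sym2`: the collapse `ρ_g` kills a gate containing `g`
up to orientation. `no_three_preimages`: three pairwise Sym2-different loopless non-`e` edges never have one
`r_e`-image (`slide_partner` twice). `rename_repL_fourGates`: `ρ_e` of a four-gate circuit with `e` in the first
gate. `collapsed_cond`: the collapsed edges of a gate of oriented edges avoiding `e` are loopless and live at level
`[e]` (`map_repL_cond`). `kiPer_fourGates_free` (E3a): a FREE collapse `ρ_e f ≠ 0`, `e` in a gate avoided by the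
three others (those of one size), contradicts `φ f = 0` — re-orient the three collapsed gates (`exists_oriented`,
signs into the coefficients) and run THEOREM A `wordL_threeGates_eqCard` at level `L = [e]` (`2·3³ = 54 < 64 ≤ m²`,
`m ≥ 8`) against `φ_[e] ∘ ρ_e = φ_[e]` (`bind₁_wordL_rename_repL`) and `φ f = 0 ⟹ φ_[e] f = 0`
(`bind₁_wordL_eq_zero_of_kiPer`). `fourGates_stuck_labels` (E3b): if `ρ_e f = 0` for an edge `e` of one gate, the
three other gates being pairwise edge-disjoint with nonzero coefficients and two of them nonempty, then ALL their
endpoints lie in at most FIVE labels — `ρ_e f = 0` is an identically vanishing three-gate circuit on the collapsed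
gates; collapsing it once more along any collapsed edge shows, with `no_three_preimages`, that the collapsed gates
are pairwise disjoint as unordered pairs (`eprod_map_repL_eq_zero`, `eprod_ne_zero`, `eq_or_swap_of_repL_eq`), so
the slides `slide_of_rename_threeGates_eq_zero` hold in all directions and the VERTEX-SUPPORT COUNT
`card_labels_le_four` gives four labels; add the merged-away label `e.2`.

HONEST BOUNDARY (O-L5-LEVEL): proved here are (A) level-stable survival of THREE equal-size graphical gates on
oriented live edges under every patch list L whose merged labels are pairwise distinct, with 2·3^(|L|+2) < m², and
(B) hitting by G_m of every nonzero sum of FOUR pairwise edge-disjoint graphical gates on oriented edges for m ≥ 8,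
on every union support; NOT claimed: four gates with an edge shared by exactly two of them (this needs a
classification of slide-equivalent gate pairs, not done), five or more gates (the free recursion leaves the pairwise
edge-disjoint class), the k-set analogue of the four-label count, affine non-graphical forms, the leaf regime;
nothing here is S-currency, no item closes, stmt-23704 and VP ≠ VNP are untouched.

USE: `DefinabilityGapGraphicalFour` (THEOREM B). 0 S-currency · closes NO item · stmt-23704 TEXT / K1 / VP ≠ VNP
untouched · UNDECIDED · IDEA-NEEDED (fan-in 4 with an edge shared by exactly two gates, fan-in ≥ 5, (β), (γ)).
-/

open MvPolynomial
open Literature.Computability.AlgebraicComplexity Literature.Computability.MetaComplexity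
open Summit.ValiantsHypothesis.ValiantsHypothesis.Theorems.DefinabilityGapAffineRung
open Summit.ValiantsHypothesis.ValiantsHypothesis.Theorems.DefinabilityGapBlockMerging
open Summit.ValiantsHypothesis.ValiantsHypothesis.Theorems.DefinabilityGapClusterMerging
open Summit.ValiantsHypothesis.ValiantsHypothesis.Theorems.DefinabilityGapForestSums
open Summit.ValiantsHypothesis.ValiantsHypothesis.Theorems.DefinabilityGapSupportRung
open Summit.ValiantsHypothesis.ValiantsHypothesis.Theorems.DefinabilityGapEdgeGates
open Summit.ValiantsHypothesis.ValiantsHypothesis.Theorems.DefinabilityGapSlideCount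
open Summit.ValiantsHypothesis.ValiantsHypothesis.Theorems.DefinabilityGapSlideSupport
open Summit.ValiantsHypothesis.ValiantsHypothesis.Theorems.DefinabilityGapThreeGatesPatched

set_option linter.dupNamespace false

namespace Summit.ValiantsHypothesis.ValiantsHypothesis.Theorems.DefinabilityGapFourGatesTools

variable {m : ℕ}

/-! ## 1. Re-orientation, collapses, preimages -/

/-- Re-orientation: every loopless gate equals `±` a gate on oriented edges with the same endpoints. -/
theorem exists_oriented {G : Multiset ((Fin 3 → Fin (qOf m)) × (Fin 3 → Fin (qOf m)))}
    (hG : ∀ g ∈ G, g.1 ≠ g.2) :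
    ∃ G' : Multiset ((Fin 3 → Fin (qOf m)) × (Fin 3 → Fin (qOf m))),
      Multiset.card G' = Multiset.card G ∧ (∀ g ∈ G', toLex g.1 < toLex g.2) ∧
      (∀ g ∈ G', g ∈ G ∨ g.swap ∈ G) ∧ (eprod G' = eprod G ∨ eprod G' = -eprod G) := by
  induction G using Multiset.induction_on with
  | empty =>
    exact ⟨0, rfl, fun g hg => (Multiset.notMem_zero g hg).elim, fun g hg => (Multiset.notMem_zero g hg).elim,
      Or.inl rfl⟩
  | cons d G ih =>
    obtain ⟨G', hc, ho, hmem, hs⟩ := ih fun g hg => hG g (Multiset.mem_cons_of_mem hg)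
    have hd : d.1 ≠ d.2 := hG d (Multiset.mem_cons_self d G)
    have hmem' : ∀ d' : (Fin 3 → Fin (qOf m)) × (Fin 3 → Fin (qOf m)), (d' = d ∨ d' = d.swap) →
        ∀ g ∈ d' ::ₘ G', g ∈ d ::ₘ G ∨ g.swap ∈ d ::ₘ G := by
      intro d' hd' g hg
      rcases Multiset.mem_cons.1 hg with rfl | hg
      · rcases hd' with rfl | rfl
        · exact Or.inl (Multiset.mem_cons_self _ _)
        · right; rw [Prod.swap_swap]; exact Multiset.mem_cons_self _ _
      · rcases hmem g hg with h | h
        · exact Or.inl (Multiset.mem_cons_of_mem h)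
        · exact Or.inr (Multiset.mem_cons_of_mem h)
    rcases lt_or_gt_of_ne (fun h => hd (toLex.injective h)) with hlt | hgt
    · refine ⟨d ::ₘ G', by rw [Multiset.card_cons, Multiset.card_cons, hc], ?_, hmem' d (Or.inl rfl), ?_⟩
      · intro g hg
        rcases Multiset.mem_cons.1 hg with rfl | hg
        · exact hlt
        · exact ho g hg
      · rw [eprod_cons, eprod_cons]
        rcases hs with hs | hs
        · left; rw [hs]
        · right; rw [hs, mul_neg]
    · refine ⟨d.swap ::ₘ G', by rw [Multiset.card_cons, Multiset.card_cons, hc], ?_, hmem' d.swap (Or.inr rfl), ?_⟩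
      · intro g hg
        rcases Multiset.mem_cons.1 hg with rfl | hg
        · exact hgt
        · exact ho g hg
      · rw [eprod_cons, eprod_cons, Prod.fst_swap, Prod.snd_swap]
        rcases hs with hs | hs
        · right; rw [hs]; ring
        · left; rw [hs]; ring

/-- Collapsing along `g` kills a gate containing `g` up to orientation. [this file] -/
theorem eprod_map_repL_eq_zero_of_sym2 {G : Multiset ((Fin 3 → Fin (qOf m)) × (Fin 3 → Fin (qOf m)))}
    {g g' : (Fin 3 → Fin (qOf m)) × (Fin 3 → Fin (qOf m))} (hg : g.1 ≠ g.2) (hg' : g' ∈ G)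
    (hs : s(g'.1, g'.2) = s(g.1, g.2)) : eprod (G.map fun d => (repL [g] d.1, repL [g] d.2)) = 0 := by
  have hrep : ∀ c : Fin 3 → Fin (qOf m), repL [g] c = if c = g.2 then g.1 else c := fun c => rfl
  refine eprod_eq_zero_of_mem (u := g.1) (Multiset.mem_map.2 ⟨g', hg', ?_⟩)
  rw [hrep, hrep]
  rcases Sym2.eq_iff.1 hs with ⟨h1, h2⟩ | ⟨h1, h2⟩
  · rw [h1, h2, if_neg hg, if_pos rfl]
  · rw [h1, h2, if_pos rfl, if_neg hg]

/-- THREE pairwise different loopless non-`e` edges never share their `r_e`-collapse (`slide_partner` twice).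
[this file] -/
theorem no_three_preimages {e d₂ d₃ d₄ : (Fin 3 → Fin (qOf m)) × (Fin 3 → Fin (qOf m))} (hne : e.1 ≠ e.2)
    (h₂ : d₂.1 ≠ d₂.2) (h₃ : d₃.1 ≠ d₃.2) (h₄ : d₄.1 ≠ d₄.2) (he₂ : s(d₂.1, d₂.2) ≠ s(e.1, e.2))
    (he₃ : s(d₃.1, d₃.2) ≠ s(e.1, e.2)) (he₄ : s(d₄.1, d₄.2) ≠ s(e.1, e.2))
    (h₂₃ : s(d₂.1, d₂.2) ≠ s(d₃.1, d₃.2)) (h₂₄ : s(d₂.1, d₂.2) ≠ s(d₄.1, d₄.2))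
    (h₃₄ : s(d₃.1, d₃.2) ≠ s(d₄.1, d₄.2))
    (m₂₃ : Sym2.map (fun c => if c = e.2 then e.1 else c) s(d₂.1, d₂.2) =
      Sym2.map (fun c => if c = e.2 then e.1 else c) s(d₃.1, d₃.2))
    (m₂₄ : Sym2.map (fun c => if c = e.2 then e.1 else c) s(d₂.1, d₂.2) =
      Sym2.map (fun c => if c = e.2 then e.1 else c) s(d₄.1, d₄.2)) : False := by
  obtain ⟨x, hxu, hxv, hx⟩ := slide_partner h₂ h₃ he₂ he₃ h₂₃ m₂₃
  obtain ⟨y, _, hyv, hy⟩ := slide_partner h₂ h₄ he₂ he₄ h₂₄ m₂₄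
  rcases hx with ⟨hx₂, hx₃⟩ | ⟨hx₂, hx₃⟩
  · rcases hy with ⟨hy₂, hy₄⟩ | ⟨hy₂, hy₄⟩
    · rcases Sym2.eq_iff.1 (hx₂.symm.trans hy₂) with ⟨_, hxy⟩ | ⟨_, hxy⟩
      · rw [hxy] at hx₃; exact h₃₄ (hx₃.trans hy₄.symm)
      · exact hxu hxy
    · rcases Sym2.eq_iff.1 (hx₂.symm.trans hy₂) with ⟨h1, _⟩ | ⟨_, h2⟩
      · exact hne h1
      · exact hxv h2
  · rcases hy with ⟨hy₂, hy₄⟩ | ⟨hy₂, hy₄⟩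
    · rcases Sym2.eq_iff.1 (hx₂.symm.trans hy₂) with ⟨h1, _⟩ | ⟨_, h2⟩
      · exact hne h1.symm
      · exact hxu h2
    · rcases Sym2.eq_iff.1 (hx₂.symm.trans hy₂) with ⟨_, hxy⟩ | ⟨_, hxy⟩
      · rw [hxy] at hx₃; exact h₃₄ (hx₃.trans hy₄.symm)
      · exact hxv hxy

/-- `ρ_e` of a four-gate circuit with `e` in the first gate. [this file] -/
theorem rename_repL_fourGates {E₁ E₂ E₃ E₄ : Multiset ((Fin 3 → Fin (qOf m)) × (Fin 3 → Fin (qOf m)))}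
    {e : (Fin 3 → Fin (qOf m)) × (Fin 3 → Fin (qOf m))} (he : e ∈ E₁) (α₁ α₂ α₃ α₄ : ℂ) :
    rename (repL [e]) (C α₁ * eprod E₁ + C α₂ * eprod E₂ + C α₃ * eprod E₃ + C α₄ * eprod E₄) =
      C α₂ * eprod (E₂.map fun d => (repL [e] d.1, repL [e] d.2)) +
        C α₃ * eprod (E₃.map fun d => (repL [e] d.1, repL [e] d.2)) +
        C α₄ * eprod (E₄.map fun d => (repL [e] d.1, repL [e] d.2)) := by
  rw [map_add, rename_repL_threeGates he, map_mul, rename_C, rename_eprod]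

/-- The collapsed edges of a gate `N ⊆ S` of ORIENTED edges avoiding the edge `e ∈ S` are loopless and live at
level `[e]`. [this file] -/
theorem collapsed_cond {S N : Multiset ((Fin 3 → Fin (qOf m)) × (Fin 3 → Fin (qOf m)))}
    (ho : ∀ d ∈ S, toLex d.1 < toLex d.2) {e : (Fin 3 → Fin (qOf m)) × (Fin 3 → Fin (qOf m))} (he : e ∈ S)
    (hN : ∀ d ∈ N, d ∈ S) (heN : e ∉ N) :
    ∀ x ∈ N.map (fun d => (repL [e] d.1, repL [e] d.2)),
      x.1 ≠ x.2 ∧ (∀ p ∈ [e], x.1 ≠ p.2) ∧ ∀ p ∈ [e], x.2 ≠ p.2 := by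
  have hoe := ho e he
  have hne : e.1 ≠ e.2 := fun h => hoe.ne (congrArg toLex h)
  have hnil : ∀ p ∈ ([] : List ((Fin 3 → Fin (qOf m)) × (Fin 3 → Fin (qOf m)))), e.1 ≠ p.2 :=
    fun p hp => by simp at hp
  refine map_repL_cond hne hnil (fun d hd => ⟨fun h => (ho d (hN d hd)).ne (congrArg toLex h),
    fun p hp => by simp at hp, fun p hp => by simp at hp⟩) fun d hd => ?_
  exact sym2_ne_of_toLex_lt (ho d (hN d hd)) hoe fun h => heN (h ▸ hd)

/-! ## 2. The two halves of the fan-in-4 dichotomy -/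

/-- (E3a, fan-in 4) a FREE collapse `ρ_e f ≠ 0`, `e` in the first gate avoided by the three others of one size:
re-orient the three collapsed gates (`exists_oriented`) and run THEOREM A at level `L = [e]`
(`2·3³ = 54 < 64 ≤ m²`), against CONTRACT `φ_[e] ∘ ρ_e = φ_[e]` and `φ f = 0 ⟹ φ_[e] f = 0`. [this file] -/
theorem kiPer_fourGates_free (hm : 8 ≤ m)
    {F₁ F₂ F₃ F₄ : Multiset ((Fin 3 → Fin (qOf m)) × (Fin 3 → Fin (qOf m)))} {γ₁ γ₂ γ₃ γ₄ : ℂ}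
    (ho : ∀ d ∈ F₁ + F₂ + F₃ + F₄, toLex d.1 < toLex d.2)
    (h₁₂ : ∀ d ∈ F₁, d ∉ F₂) (h₁₃ : ∀ d ∈ F₁, d ∉ F₃) (h₁₄ : ∀ d ∈ F₁, d ∉ F₄)
    (c₃ : Multiset.card F₃ = Multiset.card F₂) (c₄ : Multiset.card F₄ = Multiset.card F₂)
    {e : (Fin 3 → Fin (qOf m)) × (Fin 3 → Fin (qOf m))} (he : e ∈ F₁)
    (hρ : rename (repL [e]) (C γ₁ * eprod F₁ + C γ₂ * eprod F₂ + C γ₃ * eprod F₃ + C γ₄ * eprod F₄) ≠ 0) :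
    bind₁ (kiPer m) (C γ₁ * eprod F₁ + C γ₂ * eprod F₂ + C γ₃ * eprod F₃ + C γ₄ * eprod F₄) ≠ 0 := by
  intro h0
  have mF₁ : ∀ d ∈ F₁, d ∈ F₁ + F₂ + F₃ + F₄ := fun d hd =>
    Multiset.mem_add.2 (Or.inl (Multiset.mem_add.2 (Or.inl (Multiset.mem_add.2 (Or.inl hd)))))
  have mF₂ : ∀ d ∈ F₂, d ∈ F₁ + F₂ + F₃ + F₄ := fun d hd =>
    Multiset.mem_add.2 (Or.inl (Multiset.mem_add.2 (Or.inl (Multiset.mem_add.2 (Or.inr hd)))))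
  have mF₃ : ∀ d ∈ F₃, d ∈ F₁ + F₂ + F₃ + F₄ := fun d hd =>
    Multiset.mem_add.2 (Or.inl (Multiset.mem_add.2 (Or.inr hd)))
  have mF₄ : ∀ d ∈ F₄, d ∈ F₁ + F₂ + F₃ + F₄ := fun d hd => Multiset.mem_add.2 (Or.inr hd)
  have hc₂ := collapsed_cond ho (mF₁ e he) mF₂ (h₁₂ e he)
  have hc₃ := collapsed_cond ho (mF₁ e he) mF₃ (h₁₃ e he)
  have hc₄ := collapsed_cond ho (mF₁ e he) mF₄ (h₁₄ e he)
  -- re-orientation with signs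
  have hsg : ∀ (G G' : Multiset ((Fin 3 → Fin (qOf m)) × (Fin 3 → Fin (qOf m)))) (γ : ℂ),
      (eprod G' = eprod G ∨ eprod G' = -eprod G) → ∃ γ' : ℂ, C γ * eprod G = C γ' * eprod G' := by
    intro G G' γ h
    rcases h with h | h
    · exact ⟨γ, by rw [h]⟩
    · exact ⟨-γ, by rw [h, map_neg]; ring⟩
  obtain ⟨G₂, k₂, ho₂, hm₂, hs₂⟩ := exists_oriented fun x hx => (hc₂ x hx).1
  obtain ⟨G₃, k₃, ho₃, hm₃, hs₃⟩ := exists_oriented fun x hx => (hc₃ x hx).1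
  obtain ⟨G₄, k₄, ho₄, hm₄, hs₄⟩ := exists_oriented fun x hx => (hc₄ x hx).1
  obtain ⟨γ₂', e₂⟩ := hsg _ _ γ₂ hs₂
  obtain ⟨γ₃', e₃⟩ := hsg _ _ γ₃ hs₃
  obtain ⟨γ₄', e₄⟩ := hsg _ _ γ₄ hs₄
  have hρf : rename (repL [e]) (C γ₁ * eprod F₁ + C γ₂ * eprod F₂ + C γ₃ * eprod F₃ + C γ₄ * eprod F₄) =
      C γ₂' * eprod G₂ + C γ₃' * eprod G₃ + C γ₄' * eprod G₄ := by
    rw [rename_repL_fourGates he, e₂, e₃, e₄]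
  -- the re-oriented collapsed edges are oriented and live at level `[e]`
  have aux : ∀ (N G : Multiset ((Fin 3 → Fin (qOf m)) × (Fin 3 → Fin (qOf m)))),
      (∀ x ∈ N.map (fun d => (repL [e] d.1, repL [e] d.2)),
        x.1 ≠ x.2 ∧ (∀ p ∈ [e], x.1 ≠ p.2) ∧ ∀ p ∈ [e], x.2 ≠ p.2) →
      (∀ g ∈ G, toLex g.1 < toLex g.2) →
      (∀ g ∈ G, g ∈ N.map (fun d => (repL [e] d.1, repL [e] d.2)) ∨
        g.swap ∈ N.map (fun d => (repL [e] d.1, repL [e] d.2))) →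
      ∀ d ∈ G, toLex d.1 < toLex d.2 ∧ (∀ p ∈ [e], d.1 ≠ p.2) ∧ ∀ p ∈ [e], d.2 ≠ p.2 := by
    intro N G hN hoG hmG d hd
    refine ⟨hoG d hd, ?_⟩
    rcases hmG d hd with h | h
    · exact (hN d h).2
    · exact ⟨(hN d.swap h).2.2, (hN d.swap h).2.1⟩
  have hlive : ∀ d ∈ G₂ + G₃ + G₄, toLex d.1 < toLex d.2 ∧ (∀ p ∈ [e], d.1 ≠ p.2) ∧ ∀ p ∈ [e], d.2 ≠ p.2 := by
    intro d hd
    rcases Multiset.mem_add.1 hd with hd | hd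
    · rcases Multiset.mem_add.1 hd with hd | hd
      · exact aux F₂ G₂ hc₂ ho₂ hm₂ d hd
      · exact aux F₃ G₃ hc₃ ho₃ hm₃ d hd
    · exact aux F₄ G₄ hc₄ ho₄ hm₄ d hd
  have h54 : 2 * 3 ^ ([e].length + 2) < m * m :=
    lt_of_lt_of_le (by rw [List.length_singleton]; norm_num) (Nat.mul_le_mul hm hm)
  refine wordL_threeGates_eqCard (List.pairwise_singleton _ e) h54 (Multiset.card F₂) G₂ G₃ G₄ γ₂' γ₃' γ₄'
    (by rw [k₂, Multiset.card_map]) (by rw [k₃, Multiset.card_map, c₃]) (by rw [k₄, Multiset.card_map, c₄])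
    hlive ?_ ?_
  · rw [← hρf]; exact hρ
  · rw [← hρf, bind₁_wordL_rename_repL (List.mem_singleton_self e), bind₁_wordL_eq_zero_of_kiPer [e] h0]

/-- (E3b, fan-in 4) STUCK: if `ρ_e f = 0` for an edge `e` of the first gate (all coefficients of the other three
gates nonzero, gates pairwise edge-disjoint on oriented edges), then ALL endpoints of the three other gates lie in a
set of at most FIVE labels: `ρ_e f = 0` is an identically vanishing three-gate circuit on the collapsed gates, whose
collapsed edge sets are pairwise disjoint as unordered pairs (`no_three_preimages`) and slide in all directions
(`slide_of_rename_threeGates_eq_zero`), so the VERTEX-SUPPORT COUNT `card_labels_le_four` applies; add the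
merged-away label `e.2`. [this file] -/
theorem fourGates_stuck_labels
    {F₁ F₂ F₃ F₄ : Multiset ((Fin 3 → Fin (qOf m)) × (Fin 3 → Fin (qOf m)))} {γ₁ γ₂ γ₃ γ₄ : ℂ}
    (ho : ∀ d ∈ F₁ + F₂ + F₃ + F₄, toLex d.1 < toLex d.2)
    (h₁₂ : ∀ d ∈ F₁, d ∉ F₂) (h₁₃ : ∀ d ∈ F₁, d ∉ F₃) (h₁₄ : ∀ d ∈ F₁, d ∉ F₄)
    (h₂₃ : ∀ d ∈ F₂, d ∉ F₃) (h₂₄ : ∀ d ∈ F₂, d ∉ F₄) (h₃₄ : ∀ d ∈ F₃, d ∉ F₄)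
    (hγ₂ : γ₂ ≠ 0) (hγ₃ : γ₃ ≠ 0) (hγ₄ : γ₄ ≠ 0) (hn₂ : F₂ ≠ 0) (hn₃ : F₃ ≠ 0)
    {e : (Fin 3 → Fin (qOf m)) × (Fin 3 → Fin (qOf m))} (he : e ∈ F₁)
    (hρ : rename (repL [e]) (C γ₁ * eprod F₁ + C γ₂ * eprod F₂ + C γ₃ * eprod F₃ + C γ₄ * eprod F₄) = 0) :
    ∃ T : Finset (Fin 3 → Fin (qOf m)), T.card ≤ 5 ∧ ∀ d ∈ F₂ + F₃ + F₄, d.1 ∈ T ∧ d.2 ∈ T := by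
  have mF₁ : ∀ d ∈ F₁, d ∈ F₁ + F₂ + F₃ + F₄ := fun d hd =>
    Multiset.mem_add.2 (Or.inl (Multiset.mem_add.2 (Or.inl (Multiset.mem_add.2 (Or.inl hd)))))
  have mF₂ : ∀ d ∈ F₂, d ∈ F₁ + F₂ + F₃ + F₄ := fun d hd =>
    Multiset.mem_add.2 (Or.inl (Multiset.mem_add.2 (Or.inl (Multiset.mem_add.2 (Or.inr hd)))))
  have mF₃ : ∀ d ∈ F₃, d ∈ F₁ + F₂ + F₃ + F₄ := fun d hd =>
    Multiset.mem_add.2 (Or.inl (Multiset.mem_add.2 (Or.inr hd)))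
  have mF₄ : ∀ d ∈ F₄, d ∈ F₁ + F₂ + F₃ + F₄ := fun d hd => Multiset.mem_add.2 (Or.inr hd)
  have hoe : toLex e.1 < toLex e.2 := ho e (mF₁ e he)
  have hne : e.1 ≠ e.2 := fun h => hoe.ne (congrArg toLex h)
  have hrep : ∀ c : Fin 3 → Fin (qOf m), repL [e] c = if c = e.2 then e.1 else c := fun c => rfl
  -- the identically vanishing three-gate circuit of the collapsed gates
  have hid : C γ₂ * eprod (F₂.map fun d => (repL [e] d.1, repL [e] d.2)) +
      C γ₃ * eprod (F₃.map fun d => (repL [e] d.1, repL [e] d.2)) +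
      C γ₄ * eprod (F₄.map fun d => (repL [e] d.1, repL [e] d.2)) = 0 := by
    rw [← rename_repL_fourGates he]; exact hρ
  have hc₂ := collapsed_cond ho (mF₁ e he) mF₂ (h₁₂ e he)
  have hc₃ := collapsed_cond ho (mF₁ e he) mF₃ (h₁₃ e he)
  have hc₄ := collapsed_cond ho (mF₁ e he) mF₄ (h₁₄ e he)
  -- (i) the collapsed gates are pairwise disjoint as unordered pairs
  have hdis : ∀ (P Q R : Multiset ((Fin 3 → Fin (qOf m)) × (Fin 3 → Fin (qOf m)))) (p q r : ℂ),
      (∀ d ∈ P, d ∈ F₁ + F₂ + F₃ + F₄) → (∀ d ∈ Q, d ∈ F₁ + F₂ + F₃ + F₄) →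
      (∀ d ∈ R, d ∈ F₁ + F₂ + F₃ + F₄) → (∀ d ∈ P, d ∉ Q) → (∀ d ∈ P, d ∉ R) → (∀ d ∈ Q, d ∉ R) →
      e ∉ P → e ∉ Q → e ∉ R → r ≠ 0 →
      C p * eprod (P.map fun d => (repL [e] d.1, repL [e] d.2)) +
        C q * eprod (Q.map fun d => (repL [e] d.1, repL [e] d.2)) +
        C r * eprod (R.map fun d => (repL [e] d.1, repL [e] d.2)) = 0 →
      ∀ x ∈ P.map (fun d => (repL [e] d.1, repL [e] d.2)), ∀ y ∈ Q.map (fun d => (repL [e] d.1, repL [e] d.2)),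
        s(x.1, x.2) ≠ s(y.1, y.2) := by
    intro P Q R p q r hP hQ hR hPQ hPR hQR heP heQ heR hr hid x hx y hy hs
    have hxl : x.1 ≠ x.2 := (collapsed_cond ho (mF₁ e he) hP heP x hx).1
    -- collapse the identity once more, along `x`: the `P`- and `Q`-gates die, so the `R`-gate dies
    have h4 : eprod ((R.map fun d => (repL [e] d.1, repL [e] d.2)).map
        fun d => (repL [x] d.1, repL [x] d.2)) = 0 := by
      have h := congrArg (rename (repL [x])) hid
      rw [map_add, map_add, map_mul, map_mul, map_mul, rename_C, rename_C, rename_C, rename_eprod, rename_eprod,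
        rename_eprod, map_zero, eprod_map_repL_eq_zero hx, eprod_map_repL_eq_zero_of_sym2 hxl hy hs.symm, mul_zero,
        mul_zero, zero_add, zero_add] at h
      exact (mul_eq_zero.1 h).resolve_left fun h' => hr (C_eq_zero.1 h')
    -- hence an edge of the collapsed `R`-gate has the unordered pair of `x`
    have hz : ∃ z ∈ R.map (fun d => (repL [e] d.1, repL [e] d.2)), s(z.1, z.2) = s(x.1, x.2) := by
      by_contra hcon
      push Not at hcon
      refine eprod_ne_zero (fun w hw => ?_) h4
      obtain ⟨z, hz, rfl⟩ := Multiset.mem_map.1 hw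
      exact fun hw' => hcon z hz (eq_or_swap_of_repL_eq x z (collapsed_cond ho (mF₁ e he) hR heR z hz).1 hw')
    obtain ⟨z, hz, hzx⟩ := hz
    -- three preimages in three different gates with one collapse: impossible
    obtain ⟨d₂, hd₂, rfl⟩ := Multiset.mem_map.1 hx
    obtain ⟨d₃, hd₃, rfl⟩ := Multiset.mem_map.1 hy
    obtain ⟨d₄, hd₄, rfl⟩ := Multiset.mem_map.1 hz
    have o₂ := ho d₂ (hP d₂ hd₂)
    have o₃ := ho d₃ (hQ d₃ hd₃)
    have o₄ := ho d₄ (hR d₄ hd₄)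
    exact no_three_preimages hne (fun h => o₂.ne (congrArg toLex h)) (fun h => o₃.ne (congrArg toLex h))
      (fun h => o₄.ne (congrArg toLex h)) (sym2_ne_of_toLex_lt o₂ hoe fun h => heP (h ▸ hd₂))
      (sym2_ne_of_toLex_lt o₃ hoe fun h => heQ (h ▸ hd₃)) (sym2_ne_of_toLex_lt o₄ hoe fun h => heR (h ▸ hd₄))
      (sym2_ne_of_toLex_lt o₂ o₃ fun h => hPQ d₂ hd₂ (h ▸ hd₃))
      (sym2_ne_of_toLex_lt o₂ o₄ fun h => hPR d₂ hd₂ (h ▸ hd₄))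
      (sym2_ne_of_toLex_lt o₃ o₄ fun h => hQR d₃ hd₃ (h ▸ hd₄)) hs hzx.symm
  have d23 := hdis F₂ F₃ F₄ γ₂ γ₃ γ₄ mF₂ mF₃ mF₄ h₂₃ h₂₄ h₃₄ (h₁₂ e he) (h₁₃ e he) (h₁₄ e he) hγ₄ hid
  have d24 := hdis F₂ F₄ F₃ γ₂ γ₄ γ₃ mF₂ mF₄ mF₃ h₂₄ h₂₃ (fun d hd hd' => h₃₄ d hd' hd) (h₁₂ e he) (h₁₄ e he)
    (h₁₃ e he) hγ₃ (by rw [add_right_comm]; exact hid)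
  have d34 := hdis F₃ F₄ F₂ γ₃ γ₄ γ₂ mF₃ mF₄ mF₂ h₃₄ (fun d hd hd' => h₂₃ d hd' hd) (fun d hd hd' => h₂₄ d hd' hd)
    (h₁₃ e he) (h₁₄ e he) (h₁₂ e he) hγ₂ (by rw [← add_rotate]; exact hid)
  -- (ii) the slides, from the identically vanishing circuit
  have hsl : ∀ (P Q R : Multiset ((Fin 3 → Fin (qOf m)) × (Fin 3 → Fin (qOf m)))) (p q r : ℂ), r ≠ 0 →
      (∀ z ∈ R.map (fun d => (repL [e] d.1, repL [e] d.2)), z.1 ≠ z.2) →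
      (∀ x ∈ P.map (fun d => (repL [e] d.1, repL [e] d.2)), ∀ z ∈ R.map (fun d => (repL [e] d.1, repL [e] d.2)),
        s(x.1, x.2) ≠ s(z.1, z.2)) →
      C p * eprod (P.map fun d => (repL [e] d.1, repL [e] d.2)) +
        C q * eprod (Q.map fun d => (repL [e] d.1, repL [e] d.2)) +
        C r * eprod (R.map fun d => (repL [e] d.1, repL [e] d.2)) = 0 →
      ∀ x ∈ (P.map fun d => (repL [e] d.1, repL [e] d.2)).toFinset,
        ∀ y ∈ (Q.map fun d => (repL [e] d.1, repL [e] d.2)).toFinset,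
          ∃ z ∈ (R.map fun d => (repL [e] d.1, repL [e] d.2)).toFinset,
            Sym2.map (fun c => if c = x.2 then x.1 else c) s(y.1, y.2) =
              Sym2.map (fun c => if c = x.2 then x.1 else c) s(z.1, z.2) := by
    intro P Q R p q r hr hRl hPR hid x hx y hy
    obtain ⟨z, hz, h⟩ := slide_of_rename_threeGates_eq_zero (α₁ := p) (α₂ := q) hr (Multiset.mem_toFinset.1 hx)
      (fun z hz => ⟨hRl z hz, (hPR x (Multiset.mem_toFinset.1 hx) z hz).symm⟩) (by rw [hid, map_zero]) y
      (Multiset.mem_toFinset.1 hy)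
    exact ⟨z, Multiset.mem_toFinset.2 hz, h⟩
  have l₂ : ∀ z ∈ F₂.map (fun d => (repL [e] d.1, repL [e] d.2)), z.1 ≠ z.2 := fun z hz => (hc₂ z hz).1
  have l₃ : ∀ z ∈ F₃.map (fun d => (repL [e] d.1, repL [e] d.2)), z.1 ≠ z.2 := fun z hz => (hc₃ z hz).1
  have l₄ : ∀ z ∈ F₄.map (fun d => (repL [e] d.1, repL [e] d.2)), z.1 ≠ z.2 := fun z hz => (hc₄ z hz).1
  have ne₂ : (F₂.map fun d => (repL [e] d.1, repL [e] d.2)).toFinset.Nonempty := by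
    obtain ⟨d, hd⟩ := Multiset.exists_mem_of_ne_zero hn₂
    exact ⟨_, Multiset.mem_toFinset.2 (Multiset.mem_map.2 ⟨d, hd, rfl⟩)⟩
  have ne₃ : (F₃.map fun d => (repL [e] d.1, repL [e] d.2)).toFinset.Nonempty := by
    obtain ⟨d, hd⟩ := Multiset.exists_mem_of_ne_zero hn₃
    exact ⟨_, Multiset.mem_toFinset.2 (Multiset.mem_map.2 ⟨d, hd, rfl⟩)⟩
  -- (pre-elaborated partial application: the three collapsed edge SETS)
  have key := card_labels_le_four (F₂.map fun d => (repL [e] d.1, repL [e] d.2)).toFinset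
    (F₃.map fun d => (repL [e] d.1, repL [e] d.2)).toFinset (F₄.map fun d => (repL [e] d.1, repL [e] d.2)).toFinset
  obtain ⟨T, hT4, hT⟩ := key
    (fun g hg => by
      rcases Finset.mem_union.1 hg with hg | hg
      · rcases Finset.mem_union.1 hg with hg | hg
        · exact l₂ g (Multiset.mem_toFinset.1 hg)
        · exact l₃ g (Multiset.mem_toFinset.1 hg)
      · exact l₄ g (Multiset.mem_toFinset.1 hg))
    (fun x hx y hy => d23 x (Multiset.mem_toFinset.1 hx) y (Multiset.mem_toFinset.1 hy))
    (fun x hx y hy => d24 x (Multiset.mem_toFinset.1 hx) y (Multiset.mem_toFinset.1 hy))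
    (fun x hx y hy => d34 x (Multiset.mem_toFinset.1 hx) y (Multiset.mem_toFinset.1 hy)) ne₂ ne₃
    (hsl F₂ F₃ F₄ γ₂ γ₃ γ₄ hγ₄ l₄ d24 hid)
    (hsl F₂ F₄ F₃ γ₂ γ₄ γ₃ hγ₃ l₃ d23 (by rw [add_right_comm]; exact hid))
    (hsl F₃ F₂ F₄ γ₃ γ₂ γ₄ hγ₄ l₄ d34 (by rw [add_comm (C γ₃ * _) (C γ₂ * _)]; exact hid))
    (hsl F₃ F₄ F₂ γ₃ γ₄ γ₂ hγ₂ l₂ (fun x hx z hz h => d23 z hz x hx h.symm) (by rw [← add_rotate]; exact hid))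
    (hsl F₄ F₂ F₃ γ₄ γ₂ γ₃ hγ₃ l₃ (fun x hx z hz h => d34 z hz x hx h.symm) (by rw [add_rotate]; exact hid))
  refine ⟨insert e.2 T, (Finset.card_insert_le _ _).trans (by omega), fun d hd => ?_⟩
  have hdT : repL [e] d.1 ∈ T ∧ repL [e] d.2 ∈ T := by
    rcases Multiset.mem_add.1 hd with hd | hd
    · rcases Multiset.mem_add.1 hd with hd | hd
      · exact hT _ (Finset.mem_union_left _ (Finset.mem_union_left _
          (Multiset.mem_toFinset.2 (Multiset.mem_map.2 ⟨d, hd, rfl⟩))))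
      · exact hT _ (Finset.mem_union_left _ (Finset.mem_union_right _
          (Multiset.mem_toFinset.2 (Multiset.mem_map.2 ⟨d, hd, rfl⟩))))
    · exact hT _ (Finset.mem_union_right _ (Multiset.mem_toFinset.2 (Multiset.mem_map.2 ⟨d, hd, rfl⟩)))
  have key : ∀ c : Fin 3 → Fin (qOf m), repL [e] c ∈ T → c ∈ insert e.2 T := by
    intro c hc
    rw [hrep] at hc
    by_cases h : c = e.2
    · rw [h]; exact Finset.mem_insert_self _ _
    · rw [if_neg h] at hc; exact Finset.mem_insert_of_mem hc
  exact ⟨key d.1 hdT.1, key d.2 hdT.2⟩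

end Summit.ValiantsHypothesis.ValiantsHypothesis.Theorems.DefinabilityGapFourGatesTools
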